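import Mathlib
import HarnessLib
import Literature.MathematicalPhysics.KineticTheory.LangevinChainGibbs
import Summits.AtomisticToContinuum.FouriersLaw.Theorems.JunctionLocalityInsertionRemoveCutoff
import Summits.AtomisticToContinuum.FouriersLaw.Theorems.JunctionLocalityInsertionIBP
import Summits.AtomisticToContinuum.FouriersLaw.Theorems.JunctionLocalityInsertionEnergy

/-!
# Insertion identity toolbox, VI: `S_c g ⟂` invariant functions; symmetry of `S_c`

Support file for stub `stub_insertionIdentity` (line `thermalise-then-cut-probe-insertion`, crux
`stmt-AtomisticToContinuum-11748`). Two of the three pairings of the insertion identity, for a field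
`g ∈ C²` with `g, S_c g ∈ L²(μ_T)` and `∂_{p_i} g ∈ L²(μ_T)` on the weighted sites (energy estimate),
NOT compactly supported: (P3) `∫ (S_c g) F dμ_T = 0` for every `F ∈ L²(μ_T)` invariant under
translations of the weighted momenta — cut off `g`, integrate by parts against the
`p_i`-independent weight `Fρ`, remove the cutoff; (P2) `∫ (S_c u) v dμ_T = ∫ u (S_c v) dμ_T`.
All [folklore]. No definitions.

IMPORT DISCIPLINE. This toolbox serves a stub file that must restate the skeleton's vocabulary
(`kin`, `thermo`, `junctionOU`, `deviceGenerator`, `condK`, …) verbatim inside the skeleton's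
namespace; therefore it imports no `Theorems/` file whose closure declares any of those names (e.g.
`…ThermoIBP.lean`, hence none of `…KuboCutoff/KuboDirichlet/…Aux*.lean`), and overlaps with such
files are re-derived here rather than imported.
-/

noncomputable section

open scoped ContDiff Topology ENNReal NNReal Convolution Pointwise
open MeasureTheory ProbabilityTheory Filter Set Function
open Literature.MathematicalPhysics.KineticTheory.HeatConduction

namespace Summit.AtomisticToContinuum.FouriersLaw.Cruxes.SuperadditiveResistance.InsertionToolbox

local notation "uP" i' => ((0, Pi.single i' 1) : PhaseSpace _)
local notation "uQ" i' => ((Pi.single i' 1, 0) : PhaseSpace _)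

local notation "OU⟦" T' ";" i' ";" f' ";" x' "⟧" =>
  T' * partialP i' (partialP i' f') x' - Prod.snd (x' : PhaseSpace _) i' * partialP i' f' x'
local notation "XH⟦" P' ";" f' ";" x' "⟧" =>
  ∑ i, (Prod.snd (x' : PhaseSpace _) i * partialQ i f' x' -
    partialQ i (OscillatorChain.hamiltonian P' _) x' * partialP i f' x')
local notation "GEN⟦" P' ";" T' ";" c' ";" f' ";" x' "⟧" =>
  XH⟦P' ; f' ; x'⟧ + ∑ i, c' i * OU⟦T' ; i ; f' ; x'⟧
local notation "CUT⟦" ω₂' ";" lam' ";" β' ";" γ' ";" n' ";" x' "⟧" =>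
  Real.smoothTransition (2 - OscillatorChain.hamiltonian (pinnedChain ω₂' lam' β' γ') _ x' / ((n' : ℝ) + 1))

variable {L : ℕ}

section Pairings

variable {ω₂ lam β : ℝ}

set_option hygiene false in
local notation "Pch" => pinnedChain ω₂ lam β γ
set_option hygiene false in
local notation "μ♭" => OscillatorChain.gibbsMeasure (pinnedChain ω₂ lam β γ) L T
set_option hygiene false in
local notation "ρ♭" => OscillatorChain.gibbsDensity (pinnedChain ω₂ lam β γ) L T
set_option hygiene false in
local notation "χ⟦" n' "⟧" => fun y : PhaseSpace L => CUT⟦ω₂ ; lam ; β ; γ ; n' ; y⟧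
local notation "SC⟦" T' ";" c' ";" f' ";" x' "⟧" => ∑ i, c' i * OU⟦T' ; i ; f' ; x'⟧

/-- **Pairing P3: `S_c g ⟂ F` for every `F ∈ L²(μ_T)` invariant under the thermostatted momenta.**
For `g ∈ C²` with `g, S_c g ∈ L²(μ_T)` and `∂_{p_i} g ∈ L²(μ_T)` whenever `c_i ≠ 0`, and `F ∈ L²(μ_T)`
with `F(x + t e_{p_i}) = F(x)` whenever `c_i ≠ 0`: `∫ (S_c g) F dμ_T = 0`. (Cut off `g`, integrate by
parts against the `p_i`-independent weight `F ρ`, remove the cutoff.) [folklore] -/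
theorem pinnedChain_integral_ouSum_mul_invariant (hω : 0 < ω₂) (hl : 0 ≤ lam) (hβ : 0 ≤ β)
    (γ : ℝ) (L : ℕ) {T : ℝ} (hT : 0 < T) (c : Fin L → ℝ) {g : PhaseSpace L → ℝ}
    (hg : ContDiff ℝ 2 g) (hgL2 : MemLp g 2 μ♭)
    (hSg : MemLp (fun x : PhaseSpace L => SC⟦T ; c ; g ; x⟧) 2 μ♭)
    (hdg : ∀ i, c i ≠ 0 → MemLp (partialP i g) 2 μ♭)
    {F : PhaseSpace L → ℝ} (hF : MemLp F 2 μ♭)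
    (hFinv : ∀ i, c i ≠ 0 → ∀ (x : PhaseSpace L) (t : ℝ),
      F (x + t • ((0, Pi.single i 1) : PhaseSpace L)) = F x) :
    ∫ x, SC⟦T ; c ; g ; x⟧ * F x ∂μ♭ = 0 := by
  haveI := pinnedChain_isProbabilityMeasure_gibbsMeasure hω hl hβ γ L hT
  have hU : ContDiff ℝ 1 (Pch).U := pinnedChain_contDiff_U ω₂ lam β γ
  have hV : ContDiff ℝ 1 (Pch).V := pinnedChain_contDiff_V ω₂ lam β γ
  -- the integrable products
  have hSF : Integrable (fun x : PhaseSpace L => SC⟦T ; c ; g ; x⟧ * F x) μ♭ := hSg.integrable_mul hF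
  have hgF : Integrable (fun x : PhaseSpace L => g x * F x) μ♭ := hgL2.integrable_mul hF
  have hdgF : ∀ i, c i ≠ 0 → Integrable (fun x : PhaseSpace L => partialP i g x * F x) μ♭ :=
    fun i hi => (hdg i hi).integrable_mul hF
  -- (1) the cut-off pairing vanishes: `∫ S_c(χ_n g) F dμ = 0`
  have hFρ : Integrable fun x : PhaseSpace L => F x * ρ♭ x := by
    rw [pinnedChain_integrable_mul_gibbsDensity_iff hω hl hβ γ L hT]
    exact hF.integrable one_le_two
  have h1 : ∀ n : ℕ, ∫ x, SC⟦T ; c ; fun y => CUT⟦ω₂ ; lam ; β ; γ ; n ; y⟧ * g y ; x⟧ * F x ∂μ♭ = 0 := by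
    intro n
    have hψ : ContDiff ℝ 2 fun y : PhaseSpace L => CUT⟦ω₂ ; lam ; β ; γ ; n ; y⟧ * g y :=
      (contDiff_cutoff_nat ω₂ lam β γ L n 2).mul hg
    have hψc : HasCompactSupport fun y : PhaseSpace L => CUT⟦ω₂ ; lam ; β ; γ ; n ; y⟧ * g y :=
      (hasCompactSupport_cutoff hω hl hβ γ L n).mul_right
    have key : ∫ x, SC⟦T ; c ; fun y => CUT⟦ω₂ ; lam ; β ; γ ; n ; y⟧ * g y ; x⟧ * F x * ρ♭ x = 0 := by
      have hint : ∀ i, Integrable fun x : PhaseSpace L =>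
          c i * (OU⟦T ; i ; fun y => CUT⟦ω₂ ; lam ; β ; γ ; n ; y⟧ * g y ; x⟧ * F x * ρ♭ x) := by
        intro i
        obtain ⟨Cb, hCb⟩ := (continuous_ou T hψ i).bounded_above_of_compact_support
          (hasCompactSupport_ou T hψ hψc i)
        have h := hFρ.bdd_mul (continuous_ou T hψ i).aestronglyMeasurable (ae_of_all _ hCb)
        exact (h.congr (ae_of_all _ fun x => by ring)).const_mul (c i)
      have e : (fun x : PhaseSpace L => SC⟦T ; c ; fun y => CUT⟦ω₂ ; lam ; β ; γ ; n ; y⟧ * g y ; x⟧ *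
          F x * ρ♭ x) = fun x => ∑ i, c i *
            (OU⟦T ; i ; fun y => CUT⟦ω₂ ; lam ; β ; γ ; n ; y⟧ * g y ; x⟧ * F x * ρ♭ x) := by
        funext x
        simp only [Finset.sum_mul]
        exact Finset.sum_congr rfl fun i _ => by ring
      rw [e, integral_finsetSum _ fun i _ => hint i]
      refine Finset.sum_eq_zero fun i _ => ?_
      rw [integral_const_mul]
      by_cases hi : c i = 0
      · rw [hi, zero_mul]
      · rw [integral_ou_mul_invariant hU hV hT.ne' hψ hψc i (hFinv i hi) hFρ, mul_zero]
    rw [(Pch).integral_gibbsMeasure]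
    simp only [mul_assoc] at key ⊢
    rw [key, mul_zero]
  -- (2) the limit `n → ∞`
  have hlim : Tendsto (fun n : ℕ => ∫ x, CUT⟦ω₂ ; lam ; β ; γ ; n ; x⟧ * (SC⟦T ; c ; g ; x⟧ * F x) ∂μ♭)
      atTop (𝓝 (∫ x, SC⟦T ; c ; g ; x⟧ * F x ∂μ♭)) :=
    tendsto_integral_cutoff_mul γ L _ hSF
  have hlim2 : Tendsto (fun n : ℕ => ∫ x, SC⟦T ; c ; χ⟦n⟧ ; x⟧ * (g x * F x) ∂μ♭) atTop (𝓝 0) := by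
    have : ∀ n : ℕ, ∫ x, SC⟦T ; c ; χ⟦n⟧ ; x⟧ * (g x * F x) ∂μ♭ =
        ∑ i, c i * ∫ x, OU⟦T ; i ; χ⟦n⟧ ; x⟧ * (g x * F x) ∂μ♭ := by
      intro n
      have hint : ∀ i, Integrable (fun x : PhaseSpace L => c i * (OU⟦T ; i ; χ⟦n⟧ ; x⟧ * (g x * F x))) μ♭ := by
        intro i
        obtain ⟨C, hC0, hC⟩ := exists_cutoff_bounds hω.le hl hβ γ L T
        have h := hgF.bdd_mul (continuous_ou T (contDiff_cutoff_nat ω₂ lam β γ L n 2) i).aestronglyMeasurable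
          (ae_of_all _ fun x => by rw [Real.norm_eq_abs]; exact (hC n i x).2)
        exact h.const_mul (c i)
      simp only [Finset.sum_mul]
      rw [integral_finsetSum _ fun i _ => (hint i).congr (ae_of_all _ fun x => by ring)]
      exact Finset.sum_congr rfl fun i _ => by
        rw [← integral_const_mul]; exact integral_congr_ae (ae_of_all _ fun x => by ring)
    simp only [this]
    have := tendsto_finsetSum (Finset.univ : Finset (Fin L)) fun i _ =>
      (tendsto_integral_ou_cutoff_mul hω.le hl hβ γ L T μ♭ hgF i).const_mul (c i)
    simpa using this
  have hCint : ∀ (n : ℕ) (i : Fin L), Integrable (fun x : PhaseSpace L =>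
      c i * (partialP i χ⟦n⟧ x * (partialP i g x * F x))) μ♭ := by
    intro n i
    by_cases hi : c i = 0
    · simp only [hi, zero_mul]; exact integrable_zero _ _ _
    · obtain ⟨C, hC0, hC⟩ := exists_cutoff_bounds hω.le hl hβ γ L T
      have h := (hdgF i hi).bdd_mul
        (continuous_partialP (contDiff_cutoff_nat ω₂ lam β γ L n 1) one_ne_zero i).aestronglyMeasurable
        (ae_of_all _ fun x => by
          rw [Real.norm_eq_abs]
          exact ((hC n i x).1).trans (div_le_self hC0 (by
            rw [Real.le_sqrt (by norm_num) (by positivity)]; simp)))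
      exact h.const_mul (c i)
  have hlim3 : Tendsto (fun n : ℕ => ∑ i, c i * ∫ x, partialP i χ⟦n⟧ x * (partialP i g x * F x) ∂μ♭)
      atTop (𝓝 (∑ i : Fin L, c i * (0 : ℝ))) := by
    refine tendsto_finsetSum (Finset.univ : Finset (Fin L)) fun i _ => ?_
    by_cases hi : c i = 0
    · rw [show (fun n : ℕ => c i * ∫ x, partialP i χ⟦n⟧ x * (partialP i g x * F x) ∂μ♭) =
          fun _ => c i * 0 from funext fun n => by rw [hi, zero_mul, zero_mul]]
      exact tendsto_const_nhds
    · exact (tendsto_integral_partialP_cutoff_mul hω.le hl hβ γ L μ♭ (hdgF i hi) i).const_mul (c i)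
  -- (3) the identity for each `n`
  have hn : ∀ n : ℕ, ∫ x, CUT⟦ω₂ ; lam ; β ; γ ; n ; x⟧ * (SC⟦T ; c ; g ; x⟧ * F x) ∂μ♭ =
      0 - ∫ x, SC⟦T ; c ; χ⟦n⟧ ; x⟧ * (g x * F x) ∂μ♭ -
        2 * T * ∑ i, c i * ∫ x, partialP i χ⟦n⟧ x * (partialP i g x * F x) ∂μ♭ := by
    intro n
    rw [← h1 n]
    -- integrability of the three pieces
    have hψ : ContDiff ℝ 2 fun y : PhaseSpace L => CUT⟦ω₂ ; lam ; β ; γ ; n ; y⟧ * g y :=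
      (contDiff_cutoff_nat ω₂ lam β γ L n 2).mul hg
    have hψc : HasCompactSupport fun y : PhaseSpace L => CUT⟦ω₂ ; lam ; β ; γ ; n ; y⟧ * g y :=
      (hasCompactSupport_cutoff hω hl hβ γ L n).mul_right
    have hA : Integrable (fun x : PhaseSpace L =>
        SC⟦T ; c ; fun y => CUT⟦ω₂ ; lam ; β ; γ ; n ; y⟧ * g y ; x⟧ * F x) μ♭ := by
      have hc' : Continuous fun x : PhaseSpace L => SC⟦T ; c ; fun y => CUT⟦ω₂ ; lam ; β ; γ ; n ; y⟧ * g y ; x⟧ :=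
        continuous_finsetSum _ fun i _ => continuous_const.mul (continuous_ou T hψ i)
      have hs' : HasCompactSupport fun x : PhaseSpace L =>
          SC⟦T ; c ; fun y => CUT⟦ω₂ ; lam ; β ; γ ; n ; y⟧ * g y ; x⟧ := by
        have ef : (fun x : PhaseSpace L => SC⟦T ; c ; fun y => CUT⟦ω₂ ; lam ; β ; γ ; n ; y⟧ * g y ; x⟧) =
            ∑ i, fun x : PhaseSpace L => c i * OU⟦T ; i ; fun y => CUT⟦ω₂ ; lam ; β ; γ ; n ; y⟧ * g y ; x⟧ := by
          funext x
          simp only [Finset.sum_apply]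
        rw [ef]
        exact HasCompactSupport.finset_sum fun i _ => (hasCompactSupport_ou T hψ hψc i).mul_left
      obtain ⟨Cb, hCb⟩ := hc'.bounded_above_of_compact_support hs'
      have h := (hF.integrable one_le_two).bdd_mul hc'.aestronglyMeasurable (ae_of_all _ hCb)
      exact h
    have hB : Integrable (fun x : PhaseSpace L => SC⟦T ; c ; χ⟦n⟧ ; x⟧ * (g x * F x)) μ♭ := by
      obtain ⟨C, hC0, hC⟩ := exists_cutoff_bounds hω.le hl hβ γ L T
      have hc' : Continuous fun x : PhaseSpace L => SC⟦T ; c ; χ⟦n⟧ ; x⟧ :=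
        continuous_finsetSum _ fun i _ => continuous_const.mul
          (continuous_ou T (contDiff_cutoff_nat ω₂ lam β γ L n 2) i)
      refine hgF.bdd_mul hc'.aestronglyMeasurable (c := ∑ i, |c i| * C) (ae_of_all _ fun x => ?_)
      rw [Real.norm_eq_abs]
      refine (Finset.abs_sum_le_sum_abs _ _).trans (Finset.sum_le_sum fun i _ => ?_)
      rw [abs_mul]
      exact mul_le_mul_of_nonneg_left (hC n i x).2 (abs_nonneg _)
    have hC3 : Integrable (fun x : PhaseSpace L =>
        ∑ i, c i * (partialP i χ⟦n⟧ x * (partialP i g x * F x))) μ♭ :=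
      integrable_finsetSum _ fun i _ => hCint n i
    have e : ∀ x : PhaseSpace L, CUT⟦ω₂ ; lam ; β ; γ ; n ; x⟧ * (SC⟦T ; c ; g ; x⟧ * F x) =
        SC⟦T ; c ; fun y => CUT⟦ω₂ ; lam ; β ; γ ; n ; y⟧ * g y ; x⟧ * F x -
          SC⟦T ; c ; χ⟦n⟧ ; x⟧ * (g x * F x) -
          2 * T * ∑ i, c i * (partialP i χ⟦n⟧ x * (partialP i g x * F x)) := by
      intro x
      have h := cutoff_mul_ouSum (ω₂ := ω₂) (lam := lam) (β := β) γ L T c n hg x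
      have h' : CUT⟦ω₂ ; lam ; β ; γ ; n ; x⟧ * (SC⟦T ; c ; g ; x⟧ * F x) =
          (CUT⟦ω₂ ; lam ; β ; γ ; n ; x⟧ * SC⟦T ; c ; g ; x⟧) * F x := by ring
      have hC : (2 * T * ∑ i, c i * (partialP i χ⟦n⟧ x * partialP i g x)) * F x =
          2 * T * ∑ i, c i * (partialP i χ⟦n⟧ x * (partialP i g x * F x)) := by
        rw [mul_assoc, Finset.sum_mul]
        congr 1
        exact Finset.sum_congr rfl fun i _ => by ring
      rw [h', h, sub_mul, sub_mul, hC]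
      ring
    simp only [e]
    have hAB : Integrable (fun x : PhaseSpace L =>
        SC⟦T ; c ; fun y => CUT⟦ω₂ ; lam ; β ; γ ; n ; y⟧ * g y ; x⟧ * F x -
          SC⟦T ; c ; χ⟦n⟧ ; x⟧ * (g x * F x)) μ♭ := hA.sub hB
    have hC3' : Integrable (fun x : PhaseSpace L =>
        2 * T * ∑ i, c i * (partialP i χ⟦n⟧ x * (partialP i g x * F x))) μ♭ := hC3.const_mul (2 * T)
    rw [integral_sub hAB hC3', integral_sub hA hB, integral_const_mul,
      integral_finsetSum _ fun i _ => hCint n i]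
    congr 1
    congr 1
    exact Finset.sum_congr rfl fun i _ => integral_const_mul _ _
  have hlim' : Tendsto (fun n : ℕ => ∫ x, CUT⟦ω₂ ; lam ; β ; γ ; n ; x⟧ * (SC⟦T ; c ; g ; x⟧ * F x) ∂μ♭)
      atTop (𝓝 (0 - 0 - 2 * T * ∑ i : Fin L, c i * (0 : ℝ))) := by
    simp only [hn]
    exact (tendsto_const_nhds.sub hlim2).sub (hlim3.const_mul (2 * T))
  have := tendsto_nhds_unique hlim hlim'
  simpa using this

/-- **Pairing P2: symmetry of `S_c` between a forward field and a polynomial observable.** For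
`u, v ∈ C²` with `u, S_c u, v, S_c v ∈ L²(μ_T)` and `∂_{p_i} v ∈ L²(μ_T)` whenever `c_i ≠ 0`:
`∫ (S_c u) v dμ_T = ∫ u (S_c v) dμ_T` (no compact support: cut off `v`, Green, remove the cutoff).
[folklore] -/
theorem pinnedChain_integral_ouSum_mul_comm (hω : 0 < ω₂) (hl : 0 ≤ lam) (hβ : 0 ≤ β)
    (γ : ℝ) (L : ℕ) {T : ℝ} (hT : 0 < T) (c : Fin L → ℝ) {u v : PhaseSpace L → ℝ}
    (hu : ContDiff ℝ 2 u) (huL2 : MemLp u 2 μ♭)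
    (hSu : MemLp (fun x : PhaseSpace L => SC⟦T ; c ; u ; x⟧) 2 μ♭)
    (hv : ContDiff ℝ 2 v) (hvL2 : MemLp v 2 μ♭)
    (hSv : MemLp (fun x : PhaseSpace L => SC⟦T ; c ; v ; x⟧) 2 μ♭)
    (hdv : ∀ i, c i ≠ 0 → MemLp (partialP i v) 2 μ♭) :
    ∫ x, SC⟦T ; c ; u ; x⟧ * v x ∂μ♭ = ∫ x, u x * SC⟦T ; c ; v ; x⟧ ∂μ♭ := by
  haveI := pinnedChain_isProbabilityMeasure_gibbsMeasure hω hl hβ γ L hT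
  have hU : ContDiff ℝ 1 (Pch).U := pinnedChain_contDiff_U ω₂ lam β γ
  have hV : ContDiff ℝ 1 (Pch).V := pinnedChain_contDiff_V ω₂ lam β γ
  have hρc : Continuous ρ♭ := pinnedChain_continuous_gibbsDensity ω₂ lam β γ L T
  have hSuv : Integrable (fun x : PhaseSpace L => SC⟦T ; c ; u ; x⟧ * v x) μ♭ := hSu.integrable_mul hvL2
  have huSv : Integrable (fun x : PhaseSpace L => u x * SC⟦T ; c ; v ; x⟧) μ♭ := huL2.integrable_mul hSv
  have huv : Integrable (fun x : PhaseSpace L => u x * v x) μ♭ := huL2.integrable_mul hvL2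
  have hudv : ∀ i, c i ≠ 0 → Integrable (fun x : PhaseSpace L => u x * partialP i v x) μ♭ :=
    fun i hi => huL2.integrable_mul (hdv i hi)
  -- (1) Green for each `n`: `∫ (S_c u)(χ_n v) dμ = ∫ u S_c(χ_n v) dμ`
  have h1 : ∀ n : ℕ, ∫ x, SC⟦T ; c ; u ; x⟧ * (CUT⟦ω₂ ; lam ; β ; γ ; n ; x⟧ * v x) ∂μ♭ =
      ∫ x, u x * SC⟦T ; c ; fun y => CUT⟦ω₂ ; lam ; β ; γ ; n ; y⟧ * v y ; x⟧ ∂μ♭ := by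
    intro n
    have hw : ContDiff ℝ 2 fun y : PhaseSpace L => CUT⟦ω₂ ; lam ; β ; γ ; n ; y⟧ * v y :=
      (contDiff_cutoff_nat ω₂ lam β γ L n 2).mul hv
    have hwc : HasCompactSupport fun y : PhaseSpace L => CUT⟦ω₂ ; lam ; β ; γ ; n ; y⟧ * v y :=
      (hasCompactSupport_cutoff hω hl hβ γ L n).mul_right
    refine integral_gibbsMeasure_congr (Pch) L T ?_
    have hintL : ∀ i, Integrable fun x : PhaseSpace L =>
        c i * (OU⟦T ; i ; u ; x⟧ * (CUT⟦ω₂ ; lam ; β ; γ ; n ; x⟧ * v x) * ρ♭ x) := fun i =>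
      ((((continuous_ou T hu i).mul hw.continuous).mul hρc).integrable_of_hasCompactSupport
        (hwc.mul_left.mul_right)).const_mul (c i)
    have hintR : ∀ i, Integrable fun x : PhaseSpace L =>
        c i * (u x * OU⟦T ; i ; fun y => CUT⟦ω₂ ; lam ; β ; γ ; n ; y⟧ * v y ; x⟧ * ρ♭ x) := fun i =>
      (((hu.continuous.mul (continuous_ou T hw i)).mul hρc).integrable_of_hasCompactSupport
        ((hasCompactSupport_ou T hw hwc i).mul_left.mul_right)).const_mul (c i)
    have eL : (fun x : PhaseSpace L => SC⟦T ; c ; u ; x⟧ * (CUT⟦ω₂ ; lam ; β ; γ ; n ; x⟧ * v x) * ρ♭ x) =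
        fun x => ∑ i, c i * (OU⟦T ; i ; u ; x⟧ * (CUT⟦ω₂ ; lam ; β ; γ ; n ; x⟧ * v x) * ρ♭ x) := by
      funext x; simp only [Finset.sum_mul]; exact Finset.sum_congr rfl fun i _ => by ring
    have eR : (fun x : PhaseSpace L => u x * SC⟦T ; c ; fun y => CUT⟦ω₂ ; lam ; β ; γ ; n ; y⟧ * v y ; x⟧ * ρ♭ x) =
        fun x => ∑ i, c i * (u x * OU⟦T ; i ; fun y => CUT⟦ω₂ ; lam ; β ; γ ; n ; y⟧ * v y ; x⟧ * ρ♭ x) := by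
      funext x; simp only [Finset.mul_sum, Finset.sum_mul]; exact Finset.sum_congr rfl fun i _ => by ring
    rw [eL, eR, integral_finsetSum _ fun i _ => hintL i, integral_finsetSum _ fun i _ => hintR i]
    refine Finset.sum_congr rfl fun i _ => ?_
    rw [integral_const_mul, integral_const_mul, integral_ou_mul_comm hU hV hT.ne' hu hw hwc i]
  -- (2) limits
  have hlimL : Tendsto (fun n : ℕ => ∫ x, CUT⟦ω₂ ; lam ; β ; γ ; n ; x⟧ * (SC⟦T ; c ; u ; x⟧ * v x) ∂μ♭)
      atTop (𝓝 (∫ x, SC⟦T ; c ; u ; x⟧ * v x ∂μ♭)) := tendsto_integral_cutoff_mul γ L _ hSuv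
  have hlim0 : Tendsto (fun n : ℕ => ∫ x, CUT⟦ω₂ ; lam ; β ; γ ; n ; x⟧ * (u x * SC⟦T ; c ; v ; x⟧) ∂μ♭)
      atTop (𝓝 (∫ x, u x * SC⟦T ; c ; v ; x⟧ ∂μ♭)) := tendsto_integral_cutoff_mul γ L _ huSv
  have hlim2 := tendsto_integral_ouSum_cutoff_mul hω hl hβ γ L T c μ♭ huv
  have hlim3 := tendsto_sum_weight_partialP_cutoff_mul hω hl hβ γ L c μ♭
    (Φ := fun i x => u x * partialP i v x) hudv
  -- (3) the identity for each `n`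
  have hn : ∀ n : ℕ, ∫ x, CUT⟦ω₂ ; lam ; β ; γ ; n ; x⟧ * (SC⟦T ; c ; u ; x⟧ * v x) ∂μ♭ =
      (∫ x, CUT⟦ω₂ ; lam ; β ; γ ; n ; x⟧ * (u x * SC⟦T ; c ; v ; x⟧) ∂μ♭) +
        (∫ x, SC⟦T ; c ; χ⟦n⟧ ; x⟧ * (u x * v x) ∂μ♭) +
        2 * T * ∑ i, c i * ∫ x, partialP i χ⟦n⟧ x * (u x * partialP i v x) ∂μ♭ := by
    intro n
    have e1 : ∫ x, CUT⟦ω₂ ; lam ; β ; γ ; n ; x⟧ * (SC⟦T ; c ; u ; x⟧ * v x) ∂μ♭ =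
        ∫ x, SC⟦T ; c ; u ; x⟧ * (CUT⟦ω₂ ; lam ; β ; γ ; n ; x⟧ * v x) ∂μ♭ :=
      integral_congr_ae (ae_of_all _ fun x => by ring)
    rw [e1, h1 n]
    have e : ∀ x : PhaseSpace L, u x * SC⟦T ; c ; fun y => CUT⟦ω₂ ; lam ; β ; γ ; n ; y⟧ * v y ; x⟧ =
        CUT⟦ω₂ ; lam ; β ; γ ; n ; x⟧ * (u x * SC⟦T ; c ; v ; x⟧) + SC⟦T ; c ; χ⟦n⟧ ; x⟧ * (u x * v x) +
          2 * T * ∑ i, c i * (partialP i χ⟦n⟧ x * (u x * partialP i v x)) := by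
      intro x
      have h := cutoff_mul_ouSum (ω₂ := ω₂) (lam := lam) (β := β) γ L T c n hv x
      have h' : SC⟦T ; c ; fun y => CUT⟦ω₂ ; lam ; β ; γ ; n ; y⟧ * v y ; x⟧ =
          CUT⟦ω₂ ; lam ; β ; γ ; n ; x⟧ * SC⟦T ; c ; v ; x⟧ + v x * SC⟦T ; c ; χ⟦n⟧ ; x⟧ +
            2 * T * ∑ i, c i * (partialP i χ⟦n⟧ x * partialP i v x) := by linarith
      have hC : u x * (2 * T * ∑ i, c i * (partialP i χ⟦n⟧ x * partialP i v x)) =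
          2 * T * ∑ i, c i * (partialP i χ⟦n⟧ x * (u x * partialP i v x)) := by
        simp only [Finset.mul_sum]
        exact Finset.sum_congr rfl fun i _ => by ring
      rw [h', mul_add, mul_add, hC]
      ring
    simp only [e]
    have hA : Integrable (fun x : PhaseSpace L => CUT⟦ω₂ ; lam ; β ; γ ; n ; x⟧ * (u x * SC⟦T ; c ; v ; x⟧)) μ♭ :=
      huSv.bdd_mul (contDiff_cutoff_nat ω₂ lam β γ L n 0).continuous.aestronglyMeasurable
        (ae_of_all _ fun x => by
          have h := cutoff_mem_Icc ω₂ lam β γ L n x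
          rw [Real.norm_eq_abs, abs_of_nonneg h.1]; exact h.2)
    have hB := integrable_ouSum_cutoff_mul hω hl hβ γ L T c μ♭ n huv
    have hC3 : Integrable (fun x : PhaseSpace L =>
        ∑ i, c i * (partialP i χ⟦n⟧ x * (u x * partialP i v x))) μ♭ :=
      integrable_finsetSum _ fun i _ =>
        integrable_weight_partialP_cutoff_mul hω hl hβ γ L T c μ♭ n i (hudv i)
    have hAB : Integrable (fun x : PhaseSpace L => CUT⟦ω₂ ; lam ; β ; γ ; n ; x⟧ * (u x * SC⟦T ; c ; v ; x⟧) +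
        SC⟦T ; c ; χ⟦n⟧ ; x⟧ * (u x * v x)) μ♭ := hA.add hB
    have hC3' : Integrable (fun x : PhaseSpace L =>
        2 * T * ∑ i, c i * (partialP i χ⟦n⟧ x * (u x * partialP i v x))) μ♭ := hC3.const_mul (2 * T)
    rw [integral_add hAB hC3', integral_add hA hB, integral_const_mul,
      integral_finsetSum _ fun i _ =>
        integrable_weight_partialP_cutoff_mul hω hl hβ γ L T c μ♭ n i (hudv i)]
    congr 1
    congr 1
    exact Finset.sum_congr rfl fun i _ => integral_const_mul _ _
  have hlimR : Tendsto (fun n : ℕ => ∫ x, CUT⟦ω₂ ; lam ; β ; γ ; n ; x⟧ * (SC⟦T ; c ; u ; x⟧ * v x) ∂μ♭)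
      atTop (𝓝 ((∫ x, u x * SC⟦T ; c ; v ; x⟧ ∂μ♭) + 0 + 2 * T * 0)) := by
    simp only [hn]
    exact (hlim0.add hlim2).add (hlim3.const_mul (2 * T))
  have := tendsto_nhds_unique hlimL hlimR
  simpa using this

end Pairings

/-- Registered helper stub of this support file: symmetry of the weighted thermostat sum between a `C² ∩ L²` field and an observable (no compact support). [folklore] -/
theorem helper_insertionOrthogonality : ∀ {ω₂ lam β : ℝ}, 0 < ω₂ → 0 ≤ lam → 0 ≤ β → ∀ (γ : ℝ) (L : ℕ) {T : ℝ}, 0 < T → ∀ (c : Fin L → ℝ) {u v : PhaseSpace L → ℝ}, ContDiff ℝ 2 u → MemLp u 2 ((pinnedChain ω₂ lam β γ).gibbsMeasure L T) → MemLp (fun x : PhaseSpace L => ∑ i, c i * (T * partialP i (partialP i u) x - x.2 i * partialP i u x)) 2 ((pinnedChain ω₂ lam β γ).gibbsMeasure L T) → ContDiff ℝ 2 v → MemLp v 2 ((pinnedChain ω₂ lam β γ).gibbsMeasure L T) → MemLp (fun x : PhaseSpace L => ∑ i, c i * (T * partialP i (partialP i v) x - x.2 i * partialP i v x)) 2 ((pinnedChain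 ω₂ lam β γ).gibbsMeasure L T) → (∀ i, c i ≠ 0 → MemLp (partialP i v) 2 ((pinnedChain ω₂ lam β γ).gibbsMeasure L T)) → ∫ x, (∑ i, c i * (T * partialP i (partialP i u) x - x.2 i * partialP i u x)) * v x ∂((pinnedChain ω₂ lam β γ).gibbsMeasure L T) = ∫ x, u x * (∑ i, c i * (T * partialP i (partialP i v) x - x.2 i * partialP i v x)) ∂((pinnedChain ω₂ lam β γ).gibbsMeasure L T) := by
  intro ω₂ lam β hω hl hβ γ L T hT c u v hu huL2 hSu hv hvL2 hSv hdv
  exact pinnedChain_integral_ouSum_mul_comm hω hl hβ γ L hT c hu huL2 hSu hv hvL2 hSv hdv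

end Summit.AtomisticToContinuum.FouriersLaw.Cruxes.SuperadditiveResistance.InsertionToolbox

end
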